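import Summits.NavierStokesRegularity.NavierStokesRegularity.Theorems.RellichScarSymmetricScarExistsSmallDefectSlice
import Summits.NavierStokesRegularity.NavierStokesRegularity.Theorems.RellichScarSymmetricScarExistsGaussianWindowLaw

/-!
# Crux `SymmetricScarExists` (stmt-NavierStokesRegularity-11718), line `logtime-bernoulli-certificate`:
# the bet stubs are FALSE in any world with a time-periodic non-steady apex Leray profile

Lead prover's evidence on the bet (held stubs `stub_finiteGaussianAction`,
`stub_logtimeBernoulliCertificate` of `Cruxes/SymmetricScarExists/Lines/logtime-bernoulli-certificate.lean`).
A `λ`-discretely self-similar apex profile is, in Leray's backward similarity variables, an `s`-PERIODIC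
eternal solution `U(s + L) = U(s)`, `L = 2 log λ` (Chae–Wolf 2017 §4; tree `lerayOrbit_nsRescale`,
`IsDiscretelySelfSimilar.periodic_lerayOrbit`).  For such a profile which is not steady
(`∂ₛU ≢ 0`) the Gaussian action over one period is a positive constant, so

* the action over `n` periods grows linearly: `stub_finiteGaussianAction`'s conclusion fails
  (`not_finiteGaussianAction_of_periodic`);
* any slice functional returns to its value after one period while the action it should dominate is
  positive: `stub_logtimeBernoulliCertificate`'s conclusion fails for every `V`, `c > 0`, `B`
  (`not_certificate_of_periodic`).

Hence both registered bet statements are refuted by ONE time-periodic non-steady profile in the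
weighted class `LB(C, K)` (`not_finiteGaussianActionStatement_of_periodic_world`,
`not_certificateStatement_of_periodic_world`) — the backward `λ`-DSS Type-I blow-up profile whose
(non-)existence is the open problem of Bradshaw–Tsai 2017 (OP 5.1) / Chae–Wolf 2017 (only `λ` near `1`
excluded).  Conversely in the (L)-world the class is `{0}` and both hold trivially.  No `sorry`.
-/

noncomputable section

open Set Metric Function Filter MeasureTheory Topology
open scoped ENNReal

namespace Summit.NavierStokesRegularity.NavierStokesRegularity.Theorems.SymmetricScarExists.LogtimeBernoulli

open Literature.Analysis.FluidPDE Literature.Analysis.FluidPDE.PineauVicol2026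

/-! ### Periodic functions have linearly growing interval integrals -/

/-- `∫_0^{nL} F = n ∫_0^L F` for an `L`-periodic interval-integrable `F`. [folklore] -/
theorem intervalIntegral_zero_nat_mul_of_periodic {F : ℝ → ℝ} {L : ℝ} (hper : Periodic F L)
    (hint : ∀ a b : ℝ, IntervalIntegrable F volume a b) (n : ℕ) :
    ∫ σ in (0 : ℝ)..(n * L), F σ = n * ∫ σ in (0 : ℝ)..L, F σ := by
  induction n with
  | zero => simp
  | succ n ih =>
    have hsplit : ∫ σ in (0 : ℝ)..(((n + 1 : ℕ) : ℝ) * L), F σ =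
        (∫ σ in (0 : ℝ)..(n * L), F σ) + ∫ σ in (n * L : ℝ)..(((n + 1 : ℕ) : ℝ) * L), F σ :=
      (intervalIntegral.integral_add_adjacent_intervals (hint _ _) (hint _ _)).symm
    have hshift : ∫ σ in (n * L : ℝ)..(((n + 1 : ℕ) : ℝ) * L), F σ = ∫ σ in (0 : ℝ)..L, F σ := by
      have e : ((n + 1 : ℕ) : ℝ) * L = n * L + L := by push_cast; ring
      rw [e]
      have := hper.intervalIntegral_add_eq (n * L) 0
      simpa using this
    rw [hsplit, hshift, ih]
    push_cast
    ring

/-- A periodic function with POSITIVE period integral has unbounded interval integrals: there is no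
`A` with `∫_{s₁}^{s₂} F ≤ A` for all `s₁ ≤ s₂`. [folklore] -/
theorem not_exists_bound_intervalIntegral_of_periodic {F : ℝ → ℝ} {L : ℝ} (hL : 0 < L)
    (hper : Periodic F L) (hint : ∀ a b : ℝ, IntervalIntegrable F volume a b)
    (hpos : 0 < ∫ σ in (0 : ℝ)..L, F σ) :
    ¬ ∃ A : ℝ, ∀ s₁ s₂ : ℝ, s₁ ≤ s₂ → (∫ σ in s₁..s₂, F σ) ≤ A := by
  rintro ⟨A, hA⟩
  obtain ⟨n, hn⟩ := exists_nat_gt (A / ∫ σ in (0 : ℝ)..L, F σ)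
  have h1 := hA 0 (n * L) (by positivity)
  rw [intervalIntegral_zero_nat_mul_of_periodic hper hint n] at h1
  have h2 : A < n * ∫ σ in (0 : ℝ)..L, F σ := (div_lt_iff₀ hpos).1 hn
  linarith

/-- A continuous nonnegative function which is positive at a point has positive integral over every
period interval `[0, L]`, `L > 0`, if it is `L`-periodic. [folklore] -/
theorem intervalIntegral_period_pos_of_periodic {F : ℝ → ℝ} (hF : Continuous F)
    (h0 : ∀ s, 0 ≤ F s) {L : ℝ} (hL : 0 < L) (hper : Periodic F L) {σ₀ : ℝ} (hσ₀ : 0 < F σ₀) :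
    0 < ∫ σ in (0 : ℝ)..L, F σ := by
  -- positivity on a small interval around `σ₀`
  have hev : ∀ᶠ σ in 𝓝 σ₀, 0 < F σ := hF.continuousAt.eventually (lt_mem_nhds hσ₀)
  obtain ⟨ε, hε, hball⟩ := Metric.eventually_nhds_iff.1 hev
  have hεL : 0 < min (ε / 2) (L / 2) := lt_min (by positivity) (by positivity)
  set η : ℝ := min (ε / 2) (L / 2) with hη
  have hpos_small : 0 < ∫ σ in (σ₀ - η)..(σ₀ + η), F σ := by
    refine intervalIntegral.intervalIntegral_pos_of_pos_on (hF.intervalIntegrable _ _)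
      (fun x hx => hball ?_) (by linarith)
    rw [Real.dist_eq, abs_lt]
    have h1 : η ≤ ε / 2 := min_le_left _ _
    constructor <;> linarith [hx.1, hx.2]
  -- the period interval starting at `σ₀ - η` contains it, and has the same integral as `[0, L]`
  have hmono : (∫ σ in (σ₀ - η)..(σ₀ + η), F σ) ≤ ∫ σ in (σ₀ - η)..(σ₀ - η + L), F σ := by
    refine intervalIntegral.integral_mono_interval le_rfl (by linarith) ?_
      (Eventually.of_forall fun σ => h0 σ) (hF.intervalIntegrable _ _)
    have h2 : η ≤ L / 2 := min_le_right _ _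
    linarith
  rw [hper.intervalIntegral_add_eq (σ₀ - η) 0, zero_add] at hmono
  exact lt_of_lt_of_le hpos_small hmono

/-! ### The Gaussian action density of a periodic non-steady profile -/

/-- A continuous field which does not vanish at some point has positive Gaussian energy
`∫ ‖V‖² g > 0`. [folklore] -/
theorem integral_norm_sq_mul_gaussWeight_pos {V : EuclideanSpace ℝ (Fin 3) → EuclideanSpace ℝ (Fin 3)}
    {K : ℝ} (hV : Continuous V) (hbd : ∀ y, ‖V y‖ ≤ K) {y₀ : EuclideanSpace ℝ (Fin 3)} (hy₀ : V y₀ ≠ 0) :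
    0 < ∫ y, ‖V y‖ ^ 2 * gaussWeight y := by
  have hint : Integrable fun y => ‖V y‖ ^ 2 * gaussWeight y :=
    integrable_norm_sq_mul_gaussWeight_of_bound hV hbd
  have hnn : 0 ≤ fun y => ‖V y‖ ^ 2 * gaussWeight y := fun y =>
    mul_nonneg (sq_nonneg _) (gaussWeight_pos y).le
  rw [integral_pos_iff_support_of_nonneg hnn hint]
  -- the support contains a neighbourhood of `y₀`
  have hcont : Continuous fun y => ‖V y‖ ^ 2 * gaussWeight y := (hV.norm.pow 2).mul continuous_gaussWeight
  have hpos0 : 0 < ‖V y₀‖ ^ 2 * gaussWeight y₀ := mul_pos (by positivity) (gaussWeight_pos y₀)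
  have hev : ∀ᶠ y in 𝓝 y₀, 0 < ‖V y‖ ^ 2 * gaussWeight y :=
    hcont.continuousAt.eventually (lt_mem_nhds hpos0)
  obtain ⟨ε, hε, hball⟩ := Metric.eventually_nhds_iff.1 hev
  have hsub : ball y₀ ε ⊆ support fun y => ‖V y‖ ^ 2 * gaussWeight y := fun y hy =>
    mem_support.2 (hball hy).ne'
  exact lt_of_lt_of_le (measure_ball_pos volume y₀ hε) (measure_mono hsub)

variable {U : ℝ → EuclideanSpace ℝ (Fin 3) → EuclideanSpace ℝ (Fin 3)} {P : ℝ → EuclideanSpace ℝ (Fin 3) → ℝ}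

/-- For an `L`-periodic profile the self-similar defect `∂ₛU` is `L`-periodic. [folklore] -/
theorem timeDerivWithin_univ_periodic {L : ℝ} (hper : ∀ s y, U (s + L) y = U s y) (s : ℝ)
    (y : EuclideanSpace ℝ (Fin 3)) :
    timeDerivWithin (univ : Set ℝ) U (s + L) y = timeDerivWithin (univ : Set ℝ) U s y := by
  simp only [timeDerivWithin_apply, derivWithin_univ]
  have hfun : (fun σ => U σ y) = fun σ => U (σ + L) y := funext fun σ => (hper σ y).symm
  conv_rhs => rw [hfun]
  exact (deriv_comp_add_const (fun σ => U σ y) L s).symm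

/-- **A periodic non-steady eternal Leray profile has INFINITE Gaussian action.**  If `(U, P)` is a
classical solution of the backward Leray system on all of `ℝ` with `(1 + ‖y‖)‖∂ₛU‖ ≤ K`, `L`-periodic
in `s` (`L > 0`: a `λ`-DSS profile, `L = 2 log λ`) and not steady (`∂ₛU(s₀, y₀) ≠ 0` somewhere), then
the interval integrals of the action density `F(σ) = ∫‖∂ₛU(σ)‖² g` are unbounded.
[cite: ChaeWolf2017RemovingDSS, §4 (DSS = periodic profile)] -/
theorem not_finiteGaussianAction_of_periodic {K L : ℝ}
    (hsol : IsBackwardLeraySolutionOn (univ : Set ℝ) 1 U P)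
    (hbd : ∀ s y, (1 + ‖y‖) * ‖timeDerivWithin (univ : Set ℝ) U s y‖ ≤ K)
    (hL : 0 < L) (hper : ∀ s y, U (s + L) y = U s y)
    (hns : ∃ (s₀ : ℝ) (y₀ : EuclideanSpace ℝ (Fin 3)), timeDerivWithin (univ : Set ℝ) U s₀ y₀ ≠ 0) :
    ¬ ∃ A : ℝ, ∀ s₁ s₂ : ℝ, s₁ ≤ s₂ →
      (∫ σ in s₁..s₂, (∫ y : EuclideanSpace ℝ (Fin 3),
        ‖timeDerivWithin (univ : Set ℝ) U σ y‖ ^ 2 * gaussWeight y)) ≤ A := by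
  obtain ⟨s₀, y₀, hy₀⟩ := hns
  -- the defect is jointly continuous and bounded by `K`
  have hV : IsSmoothSpaceTimeOn (univ : Set ℝ) (timeDerivWithin (univ : Set ℝ) U) :=
    hsol.smooth_velocity.timeDerivWithin uniqueDiffOn_univ
  have hc : Continuous (uncurry (timeDerivWithin (univ : Set ℝ) U)) := by
    have := hV.continuousOn
    rwa [univ_prod_univ, continuousOn_univ] at this
  have hbd' : ∀ s y, ‖timeDerivWithin (univ : Set ℝ) U s y‖ ≤ K := fun s y =>
    le_trans (le_mul_of_one_le_left (norm_nonneg _) (by linarith [norm_nonneg y])) (hbd s y)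
  have hFc := continuous_integral_norm_sq_mul_gaussWeight hc hbd'
  -- it is `L`-periodic, nonnegative, positive at `s₀`
  have hFper : Periodic (fun σ => ∫ y : EuclideanSpace ℝ (Fin 3),
      ‖timeDerivWithin (univ : Set ℝ) U σ y‖ ^ 2 * gaussWeight y) L := fun σ => by
    simp only [timeDerivWithin_univ_periodic hper]
  have hF0 : ∀ σ, 0 ≤ ∫ y : EuclideanSpace ℝ (Fin 3),
      ‖timeDerivWithin (univ : Set ℝ) U σ y‖ ^ 2 * gaussWeight y := fun σ =>
    integral_nonneg fun y => mul_nonneg (sq_nonneg _) (gaussWeight_pos y).le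
  have hFs₀ : 0 < ∫ y : EuclideanSpace ℝ (Fin 3),
      ‖timeDerivWithin (univ : Set ℝ) U s₀ y‖ ^ 2 * gaussWeight y :=
    integral_norm_sq_mul_gaussWeight_pos (hc.comp (continuous_const.prodMk continuous_id))
      (hbd' s₀) hy₀
  have hIpos := intervalIntegral_period_pos_of_periodic hFc hF0 hL hFper hFs₀
  exact not_exists_bound_intervalIntegral_of_periodic hL hFper
    (fun a b => hFc.intervalIntegrable a b) hIpos

/-- **A periodic non-steady eternal Leray profile admits NO log-time certificate**: for every slice
functional `V`, every `c > 0` and every `B`, the certificate inequalities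
`c ∫_{s₁}^{s₂} F ≤ V(U(s₁),P(s₁)) − V(U(s₂),P(s₂))` fail — over one period the right-hand side is
`0` while the action is positive. [cite: ChaeWolf2017RemovingDSS, §4 (DSS = periodic profile)] -/
theorem not_certificate_of_periodic {K L : ℝ}
    (hsol : IsBackwardLeraySolutionOn (univ : Set ℝ) 1 U P)
    (hbd : ∀ s y, (1 + ‖y‖) * ‖timeDerivWithin (univ : Set ℝ) U s y‖ ≤ K)
    (hL : 0 < L) (hper : ∀ s y, U (s + L) y = U s y) (hperP : ∀ s y, P (s + L) y = P s y)
    (hns : ∃ (s₀ : ℝ) (y₀ : EuclideanSpace ℝ (Fin 3)), timeDerivWithin (univ : Set ℝ) U s₀ y₀ ≠ 0)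
    (V : (EuclideanSpace ℝ (Fin 3) → EuclideanSpace ℝ (Fin 3)) → (EuclideanSpace ℝ (Fin 3) → ℝ) → ℝ)
    {c : ℝ} (hc : 0 < c) :
    ¬ ∀ s₁ s₂ : ℝ, s₁ ≤ s₂ → c * (∫ σ in s₁..s₂, (∫ y : EuclideanSpace ℝ (Fin 3),
        ‖timeDerivWithin (univ : Set ℝ) U σ y‖ ^ 2 * gaussWeight y)) ≤
          V (U s₁) (P s₁) - V (U s₂) (P s₂) := by
  intro hcert
  obtain ⟨s₀, y₀, hy₀⟩ := hns
  have hV' : IsSmoothSpaceTimeOn (univ : Set ℝ) (timeDerivWithin (univ : Set ℝ) U) :=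
    hsol.smooth_velocity.timeDerivWithin uniqueDiffOn_univ
  have hcU : Continuous (uncurry (timeDerivWithin (univ : Set ℝ) U)) := by
    have := hV'.continuousOn
    rwa [univ_prod_univ, continuousOn_univ] at this
  have hbd' : ∀ s y, ‖timeDerivWithin (univ : Set ℝ) U s y‖ ≤ K := fun s y =>
    le_trans (le_mul_of_one_le_left (norm_nonneg _) (by linarith [norm_nonneg y])) (hbd s y)
  have hFc := continuous_integral_norm_sq_mul_gaussWeight hcU hbd'
  have hFper : Periodic (fun σ => ∫ y : EuclideanSpace ℝ (Fin 3),
      ‖timeDerivWithin (univ : Set ℝ) U σ y‖ ^ 2 * gaussWeight y) L := fun σ => by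
    simp only [timeDerivWithin_univ_periodic hper]
  have hF0 : ∀ σ, 0 ≤ ∫ y : EuclideanSpace ℝ (Fin 3),
      ‖timeDerivWithin (univ : Set ℝ) U σ y‖ ^ 2 * gaussWeight y := fun σ =>
    integral_nonneg fun y => mul_nonneg (sq_nonneg _) (gaussWeight_pos y).le
  have hFs₀ : 0 < ∫ y : EuclideanSpace ℝ (Fin 3),
      ‖timeDerivWithin (univ : Set ℝ) U s₀ y‖ ^ 2 * gaussWeight y :=
    integral_norm_sq_mul_gaussWeight_pos (hcU.comp (continuous_const.prodMk continuous_id))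
      (hbd' s₀) hy₀
  have hIpos := intervalIntegral_period_pos_of_periodic hFc hF0 hL hFper hFs₀
  -- over one period the certificate's right-hand side vanishes
  have hU : U L = U 0 := funext fun y => by simpa using hper 0 y
  have hP : P L = P 0 := funext fun y => by simpa using hperP 0 y
  have h := hcert 0 L hL.le
  rw [hU, hP, sub_self] at h
  have : 0 < c * ∫ σ in (0 : ℝ)..L, (∫ y : EuclideanSpace ℝ (Fin 3),
      ‖timeDerivWithin (univ : Set ℝ) U σ y‖ ^ 2 * gaussWeight y) := mul_pos hc hIpos
  linarith

/-! ### The two registered bet statements in a periodic world -/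

/-- **In a world containing ONE time-periodic non-steady apex Leray profile in the weighted class
`LB(C, K)`, the registered statement of `stub_finiteGaussianAction` is FALSE.**  (Such a profile is a
backward `λ`-DSS Type-I blow-up profile — Bradshaw–Tsai 2017 OP 5.1, open; Chae–Wolf 2017 Thm 1.3
excludes only `λ` close to `1`.) [cite: ChaeWolf2017RemovingDSS, Thm 1.3 and §4] -/
theorem not_finiteGaussianActionStatement_of_periodic_world
    (hworld : ∃ (C K L : ℝ) (U : ℝ → EuclideanSpace ℝ (Fin 3) → EuclideanSpace ℝ (Fin 3)) (P : ℝ → EuclideanSpace ℝ (Fin 3) → ℝ),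
      (Literature.Analysis.FluidPDE.IsBackwardLeraySolutionOn (Set.univ : Set ℝ) 1 U P ∧ ∀ (s : ℝ) (y : EuclideanSpace ℝ (Fin 3)), (1 + ‖y‖) * ‖U s y‖ ≤ C ∧ (1 + ‖y‖) ^ 2 * ‖fderiv ℝ (U s) y‖ ≤ K ∧ (1 + ‖y‖) ^ 3 * ‖iteratedFDeriv ℝ 2 (U s) y‖ ≤ K ∧ (1 + ‖y‖) ^ 2 * |P s y| ≤ K ∧ (1 + ‖y‖) ^ 3 * ‖gradient (P s) y‖ ≤ K ∧ (1 + ‖y‖) * ‖Literature.Analysis.FluidPDE.timeDerivWithin (Set.univ : Set ℝ) U s y‖ ≤ K ∧ (1 + ‖y‖) ^ 2 * ‖fderiv ℝ (fun z => Literature.Analysis.FluidPDE.timeDerivWithin (Set.univ : Set ℝ) U s z) y‖ ≤ K ∧ (1 + ‖y‖) ^ 3 * ‖Literature.Analysis.FluidPDE.timeDerivWithin (Set.univ : Set ℝ) U s y + (1 / 2 : ℝ) • U s y + (1 / 2 : ℝ) • fderiv ℝ (U s) y y‖ ≤ K) ∧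
      0 < L ∧ (∀ s y, U (s + L) y = U s y) ∧
      ∃ (s₀ : ℝ) (y₀ : EuclideanSpace ℝ (Fin 3)), timeDerivWithin (univ : Set ℝ) U s₀ y₀ ≠ 0) :
    ¬ (∀ (C K : ℝ) (U : ℝ → EuclideanSpace ℝ (Fin 3) → EuclideanSpace ℝ (Fin 3)) (P : ℝ → EuclideanSpace ℝ (Fin 3) → ℝ), (Literature.Analysis.FluidPDE.IsBackwardLeraySolutionOn (Set.univ : Set ℝ) 1 U P ∧ ∀ (s : ℝ) (y : EuclideanSpace ℝ (Fin 3)), (1 + ‖y‖) * ‖U s y‖ ≤ C ∧ (1 + ‖y‖) ^ 2 * ‖fderiv ℝ (U s) y‖ ≤ K ∧ (1 + ‖y‖) ^ 3 * ‖iteratedFDeriv ℝ 2 (U s) y‖ ≤ K ∧ (1 + ‖y‖) ^ 2 * |P s y| ≤ K ∧ (1 + ‖y‖) ^ 3 * ‖gradient (P s) y‖ ≤ K ∧ (1 + ‖y‖) * ‖Literature.Analysis.FluidPDE.timeDerivWithin (Set.univ : Set ℝ) U s y‖ ≤ K ∧ (1 + ‖y‖) ^ 2 * ‖fderiv ℝ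 (fun z => Literature.Analysis.FluidPDE.timeDerivWithin (Set.univ : Set ℝ) U s z) y‖ ≤ K ∧ (1 + ‖y‖) ^ 3 * ‖Literature.Analysis.FluidPDE.timeDerivWithin (Set.univ : Set ℝ) U s y + (1 / 2 : ℝ) • U s y + (1 / 2 : ℝ) • fderiv ℝ (U s) y y‖ ≤ K) → (∃ A : ℝ, ∀ s₁ s₂ : ℝ, s₁ ≤ s₂ → (∫ σ in s₁..s₂, (∫ y : EuclideanSpace ℝ (Fin 3), ‖Literature.Analysis.FluidPDE.timeDerivWithin (Set.univ : Set ℝ) U σ y‖ ^ 2 * Literature.Analysis.FluidPDE.PineauVicol2026.gaussWeight y)) ≤ A)) := by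
  intro hstub
  obtain ⟨C, K, L, U, P, hLB, hL, hper, hns⟩ := hworld
  exact not_finiteGaussianAction_of_periodic hLB.1 (fun s y => (hLB.2 s y).2.2.2.2.2.1) hL hper hns
    (hstub C K U P hLB)

/-- **In the same periodic world (with the pressure profile periodic as well) the registered
statement of `stub_logtimeBernoulliCertificate` is FALSE**, whatever the window-law hypothesis says
(it is not even needed). [cite: ChaeWolf2017RemovingDSS, Thm 1.3 and §4] -/
theorem not_certificateStatement_of_periodic_world
    (hworld : ∃ (C K L : ℝ) (U : ℝ → EuclideanSpace ℝ (Fin 3) → EuclideanSpace ℝ (Fin 3)) (P : ℝ → EuclideanSpace ℝ (Fin 3) → ℝ),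
      (Literature.Analysis.FluidPDE.IsBackwardLeraySolutionOn (Set.univ : Set ℝ) 1 U P ∧ ∀ (s : ℝ) (y : EuclideanSpace ℝ (Fin 3)), (1 + ‖y‖) * ‖U s y‖ ≤ C ∧ (1 + ‖y‖) ^ 2 * ‖fderiv ℝ (U s) y‖ ≤ K ∧ (1 + ‖y‖) ^ 3 * ‖iteratedFDeriv ℝ 2 (U s) y‖ ≤ K ∧ (1 + ‖y‖) ^ 2 * |P s y| ≤ K ∧ (1 + ‖y‖) ^ 3 * ‖gradient (P s) y‖ ≤ K ∧ (1 + ‖y‖) * ‖Literature.Analysis.FluidPDE.timeDerivWithin (Set.univ : Set ℝ) U s y‖ ≤ K ∧ (1 + ‖y‖) ^ 2 * ‖fderiv ℝ (fun z => Literature.Analysis.FluidPDE.timeDerivWithin (Set.univ : Set ℝ) U s z) y‖ ≤ K ∧ (1 + ‖y‖) ^ 3 * ‖Literature.Analysis.FluidPDE.timeDerivWithin (Set.univ : Set ℝ) U s y + (1 / 2 : ℝ) • U s y + (1 / 2 : ℝ) • fderiv ℝ (U s) y y‖ ≤ K) ∧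
      0 < L ∧ (∀ s y, U (s + L) y = U s y) ∧ (∀ s y, P (s + L) y = P s y) ∧
      ∃ (s₀ : ℝ) (y₀ : EuclideanSpace ℝ (Fin 3)), timeDerivWithin (univ : Set ℝ) U s₀ y₀ ≠ 0) :
    ¬ (∀ (C K : ℝ), ∃ (V : (EuclideanSpace ℝ (Fin 3) → EuclideanSpace ℝ (Fin 3)) → (EuclideanSpace ℝ (Fin 3) → ℝ) → ℝ) (c B : ℝ), 0 < c ∧ ∀ (U : ℝ → EuclideanSpace ℝ (Fin 3) → EuclideanSpace ℝ (Fin 3)) (P : ℝ → EuclideanSpace ℝ (Fin 3) → ℝ), (Literature.Analysis.FluidPDE.IsBackwardLeraySolutionOn (Set.univ : Set ℝ) 1 U P ∧ ∀ (s : ℝ) (y : EuclideanSpace ℝ (Fin 3)), (1 + ‖y‖) * ‖U s y‖ ≤ C ∧ (1 + ‖y‖) ^ 2 * ‖fderiv ℝ (U s) y‖ ≤ K ∧ (1 + ‖y‖) ^ 3 * ‖iteratedFDeriv ℝ 2 (U s) y‖ ≤ K ∧ (1 + ‖y‖) ^ 2 * |P s y| ≤ K ∧ (1 + ‖y‖)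 ^ 3 * ‖gradient (P s) y‖ ≤ K ∧ (1 + ‖y‖) * ‖Literature.Analysis.FluidPDE.timeDerivWithin (Set.univ : Set ℝ) U s y‖ ≤ K ∧ (1 + ‖y‖) ^ 2 * ‖fderiv ℝ (fun z => Literature.Analysis.FluidPDE.timeDerivWithin (Set.univ : Set ℝ) U s z) y‖ ≤ K ∧ (1 + ‖y‖) ^ 3 * ‖Literature.Analysis.FluidPDE.timeDerivWithin (Set.univ : Set ℝ) U s y + (1 / 2 : ℝ) • U s y + (1 / 2 : ℝ) • fderiv ℝ (U s) y y‖ ≤ K) → ((∀ s : ℝ, (∫ y : EuclideanSpace ℝ (Fin 3), ‖U s y‖ ^ 2 * Literature.Analysis.FluidPDE.PineauVicol2026.gaussWeight y) ≤ C ^ 2 * (∫ y : EuclideanSpace ℝ (Fin 3), Literature.Analysis.FluidPDE.PineauVicol2026.gaussWeight y)) ∧ ∀ s₁ s₂ : ℝ, s₁ ≤ s₂ → (1 / 2 : ℝ) * (∫ y : EuclideanSpace ℝ (Fin 3), ‖U s₂ y‖ ^ 2 * Literature.Analysis.FluidPDE.PineauVicol2026.gaussWeight y) - (1 / 2 : ℝ)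 * (∫ y : EuclideanSpace ℝ (Fin 3), ‖U s₁ y‖ ^ 2 * Literature.Analysis.FluidPDE.PineauVicol2026.gaussWeight y) = -(∫ σ in s₁..s₂, ((∫ y : EuclideanSpace ℝ (Fin 3), Literature.Analysis.FluidPDE.frobeniusNormSq (fderiv ℝ (U σ) y) * Literature.Analysis.FluidPDE.PineauVicol2026.gaussWeight y) + (1 / 2 : ℝ) * (∫ y : EuclideanSpace ℝ (Fin 3), ‖U σ y‖ ^ 2 * Literature.Analysis.FluidPDE.PineauVicol2026.gaussWeight y) + (1 / 2 : ℝ) * (∫ y : EuclideanSpace ℝ (Fin 3), (P σ y + (1 / 2 : ℝ) * ‖U σ y‖ ^ 2) * inner ℝ y (U σ y) * Literature.Analysis.FluidPDE.PineauVicol2026.gaussWeight y)))) → (∀ s : ℝ, |V (U s) (P s)| ≤ B) ∧ ∀ s₁ s₂ : ℝ, s₁ ≤ s₂ → c * (∫ σ in s₁..s₂, (∫ y : EuclideanSpace ℝ (Fin 3), ‖Literature.Analysis.FluidPDE.timeDerivWithin (Set.univ : Set ℝ) U σ y‖ ^ 2 * Literature.Analysis.FluidPDE.PineauVicol2026.gaussWeight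 y)) ≤ V (U s₁) (P s₁) - V (U s₂) (P s₂)) := by
  intro hstub
  obtain ⟨C, K, L, U, P, hLB, hL, hper, hperP, hns⟩ := hworld
  obtain ⟨V, c, B, hc, hcert⟩ := hstub C K
  -- the window law hypothesis is TRUE for this profile (landed STUB 2), so the certificate applies
  have hWL := stub_gaussianWindowLaw C K U P hLB
  exact not_certificate_of_periodic hLB.1 (fun s y => (hLB.2 s y).2.2.2.2.2.1) hL hper hperP hns V hc
    (hcert U P hLB hWL).2

end Summit.NavierStokesRegularity.NavierStokesRegularity.Theorems.SymmetricScarExists.LogtimeBernoulli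

end
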